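import Literature.NumberTheory.EllipticCurves.HeegnerPoints
import Literature.NumberTheory.EllipticCurves.HeegnerPointsImaginaryQuadraticProofs
import Mathlib.Algebra.QuadraticDiscriminant
import HarnessLib

/-!
# Heegner points: finitely many `Γ₀(N)`-classes of Heegner forms; Heegner data exist (proved)

Companion to `Literature.NumberTheory.EllipticCurves.HeegnerPoints` (named facts, D-0014). This
file contains **theorems only**: it discharges the named fact `Literature.NumberTheory.EllipticCurves.nonempty_heegnerDatum`
(**existence of Heegner data**: for `K` imaginary quadratic and `β² ≡ d_K (mod 4N)` there is a
complete irredundant system of representatives of the Heegner forms `(A, B, C)` of level `N`,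
discriminant `d_K`, `B ≡ β (mod 2N)`, modulo `Γ₀(N)`; Gross 1984, §I.1; Gross–Kohnen–Zagier 1987,
§I.1) from the classical reduction theory of positive definite binary quadratic forms, carried
out at the level of the Heegner points `τ_Q ∈ ℍ` (`Literature.NumberTheory.EllipticCurves.heegnerTau`, `Literature.NumberTheory.EllipticCurves.IsGamma0Equiv`):

* `Literature.NumberTheory.EllipticCurves.eq_heegnerTau_of_isRoot`: `τ_Q` is the *unique* root of `A τ² + B τ + C` in `ℍ`
  (Cox 2013, §7.B, proof of (7.8));
* `Literature.NumberTheory.EllipticCurves.sl2_smul_heegnerTau`: for `g ∈ SL₂(ℤ)`, `g · τ_Q = τ_{Q ∘ g⁻¹}` with the coefficients of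
  `Q ∘ g⁻¹` written out, of the same discriminant (Cox 2013, (7.8)–(7.10));
* `Literature.NumberTheory.EllipticCurves.exists_sl2_smul_heegnerTau_reduced`: every positive definite form is `SL₂(ℤ)`-equivalent to
  a reduced one, `|B| ≤ A ≤ C` (Lagrange–Gauss reduction; Cox 2013, Thm. 2.8, existence part);
* `Literature.NumberTheory.EllipticCurves.finite_reducedForms`: there are finitely many reduced forms of given discriminant
  (`3A² ≤ |D|`; Cox 2013, (2.12) and Thm. 2.13);
* `Literature.NumberTheory.EllipticCurves.exists_finset_forall_isGamma0Equiv`: hence, `Γ₀(N)` having finite index in `SL₂(ℤ)`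
  (Mathlib), the positive definite forms of discriminant `D < 0` fall into finitely many
  `Γ₀(N)`-classes (Gross–Kohnen–Zagier 1987, §I.1);
* `Literature.NumberTheory.EllipticCurves.exists_heegnerDatum`: a complete irredundant system of representatives of the classes of
  Heegner forms with `B ≡ β (mod 2N)` exists (one canonical form per class, by Hilbert's `ε`);
* `Literature.nonempty_heegnerDatum_holds : nonempty_heegnerDatum N K` (with `d_K < 0` from
  `Literature.NumberTheory.EllipticCurves.IsImaginaryQuadratic.discr_neg`).

Neither the uniqueness of the reduced representative nor the count of the classes
(`#reps = h(K)`, `Literature.NumberTheory.EllipticCurves.HeegnerDatum.card_reps_eq_classNumber`, Gross 1984, §I.1) is needed or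
proved here.

## References

* B. H. Gross, *Heegner points on `X₀(N)`*, in *Modular Forms* (Durham 1983), Horwood (1984),
  87–105, §I.1.
* B. Gross, W. Kohnen, D. Zagier, *Heegner points and derivatives of `L`-series. II*,
  Math. Ann. 278 (1987), 497–562, §I.1.
* D. A. Cox, *Primes of the form `x² + ny²`*, 2nd ed., Wiley (2013), §2.A (Thm. 2.8, (2.12),
  Thm. 2.13), §7.B ((7.8)–(7.10)), Exercise 11.4.
-/

noncomputable section

open scoped MatrixGroups

open CongruenceSubgroup UpperHalfPlane

namespace Literature.NumberTheory.EllipticCurves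

/-! ### Positive definite forms and their root in `ℍ` -/

/-- A form `(A, B, C)` with `A > 0` and `B² − 4AC < 0` has `C > 0`. [folklore] -/
theorem third_pos_of_disc_neg {A B C : ℤ} (hA : 0 < A) (hD : B ^ 2 - 4 * A * C < 0) : 0 < C := by
  nlinarith [sq_nonneg B]

/-- A form `(A, B, C)` with `A > 0` and `B² − 4AC < 0` is positive definite:
`A x² + B x y + C y² > 0` for `(x, y) ≠ (0, 0)` (`4A·Q(x, y) = (2Ax + By)² + (4AC − B²) y²`).
[folklore] -/
theorem posDef_of_disc_neg {A B C : ℤ} (hA : 0 < A) (hD : B ^ 2 - 4 * A * C < 0) {x y : ℤ}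
    (h : x ≠ 0 ∨ y ≠ 0) : 0 < A * x ^ 2 + B * x * y + C * y ^ 2 := by
  have key : 4 * A * (A * x ^ 2 + B * x * y + C * y ^ 2) =
      (2 * A * x + B * y) ^ 2 + (4 * A * C - B ^ 2) * y ^ 2 := by ring
  rcases eq_or_ne y 0 with rfl | hy
  · have hx : x ≠ 0 := h.resolve_right (fun h ↦ h rfl)
    have : 0 < x ^ 2 := by positivity
    nlinarith
  · have hy2 : 0 < y ^ 2 := by positivity
    have h4 : 0 < (2 * A * x + B * y) ^ 2 + (4 * A * C - B ^ 2) * y ^ 2 := by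
      nlinarith [sq_nonneg (2 * A * x + B * y)]
    nlinarith

/-- **The root in `ℍ` is unique.** If `τ ∈ ℍ` satisfies `A τ² + B τ + C = 0` for a form with
`A > 0`, `B² − 4AC < 0`, then `τ = τ_Q = (−B + i√(4AC − B²))/(2A)` (the other root is `τ̄_Q ∉ ℍ`; Cox 2013, §7.B,
"the uniqueness of the root"). [folklore] -/
theorem eq_heegnerTau_of_isRoot {Q : ℤ × ℤ × ℤ} (hA : 0 < Q.1) (hQ : Q.2.1 ^ 2 - 4 * Q.1 * Q.2.2 < 0)
    (τ : ℍ) (h : (Q.1 : ℂ) * (τ : ℂ) ^ 2 + Q.2.1 * τ + Q.2.2 = 0) : τ = heegnerTau Q := by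
  obtain ⟨A, B, C⟩ := Q
  dsimp only at hA hQ h ⊢
  have hD : (0 : ℝ) < 4 * A * C - B ^ 2 := by
    have h2 : ((B ^ 2 - 4 * A * C : ℤ) : ℝ) < 0 := by exact_mod_cast hQ
    push_cast at h2
    linarith
  set s : ℝ := √(4 * A * C - B ^ 2 : ℝ) with hs
  have hs2 : s * s = 4 * A * C - B ^ 2 := Real.mul_self_sqrt hD.le
  have hspos : 0 < s := Real.sqrt_pos.mpr hD
  have hA' : ((A : ℝ) : ℂ) ≠ 0 := by exact_mod_cast hA.ne'
  have hdisc : discrim ((A : ℝ) : ℂ) ((B : ℝ) : ℂ) ((C : ℝ) : ℂ) =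
      (Complex.I * s) * (Complex.I * s) := by
    rw [discrim, show Complex.I * ↑s * (Complex.I * ↑s) = Complex.I ^ 2 * (s * s) by ring,
      Complex.I_sq, ← Complex.ofReal_mul, hs2]
    push_cast
    ring
  have h' : ((A : ℝ) : ℂ) * ((τ : ℂ) * (τ : ℂ)) + ((B : ℝ) : ℂ) * (τ : ℂ) + ((C : ℝ) : ℂ) = 0 := by
    rw [← sq]; exact_mod_cast h
  rcases (quadratic_eq_zero_iff hA' hdisc (τ : ℂ)).mp h' with h1 | h1
  · apply UpperHalfPlane.ext
    rw [h1, coe_heegnerTau hA hQ, ← hs]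
    apply Complex.ext
    · simp [Complex.div_re, Complex.normSq]
      field_simp
    · simp [Complex.div_im, Complex.normSq]
      field_simp
  · exfalso
    have him : (τ : ℂ).im = -s / (2 * A) := by
      rw [h1]
      simp [Complex.div_im, Complex.normSq]
      field_simp
    have : (0 : ℝ) < -s / (2 * A) := him ▸ τ.im_pos
    have hA2 : (0 : ℝ) < 2 * A := by exact_mod_cast (by linarith : (0 : ℤ) < 2 * A)
    rw [lt_div_iff₀ hA2, zero_mul] at this
    linarith

/-! ### The action of `SL₂(ℤ)` on Heegner points of `ℍ` -/

/-- For `g ∈ SL₂(ℤ)` and `τ ∈ ℍ` the denominator `c τ + d` is non-zero (integral-matrix form of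
Mathlib `UpperHalfPlane.denom_ne_zero`). [folklore] -/
theorem sl2z_denom_ne_zero (g : SL(2, ℤ)) (τ : ℍ) :
    ((g 1 0 : ℤ) : ℂ) * (τ : ℂ) + ((g 1 1 : ℤ) : ℂ) ≠ 0 := by
  intro h
  have him := congrArg Complex.im h
  simp only [Complex.add_im, Complex.mul_im, Complex.intCast_re, Complex.intCast_im, zero_mul,
    add_zero, Complex.zero_im] at him
  have hc : (g 1 0 : ℤ) = 0 := by
    rcases mul_eq_zero.mp him with h0 | h0
    · exact_mod_cast h0
    · exact absurd h0 τ.im_pos.ne'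
  have hre := congrArg Complex.re h
  simp only [Complex.intCast_re, zero_mul, Complex.zero_re, hc, Int.cast_zero, zero_add] at hre
  have hd : (g 1 1 : ℤ) = 0 := by exact_mod_cast hre
  have hdet := Matrix.det_fin_two (g : Matrix (Fin 2) (Fin 2) ℤ)
  rw [g.det_coe, hc, hd, mul_zero, mul_zero, sub_zero] at hdet
  exact zero_ne_one hdet.symm

/-- **`SL₂(ℤ)` moves Heegner points to Heegner points.** For `g = (a b; c d) ∈ SL₂(ℤ)` and a
positive definite form `Q = (A, B, C)`, `g · τ_Q = τ_{Q'}` for the form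
`Q'(X, Y) = Q(dX − bY, −cX + aY) = Q ∘ g⁻¹`, of the same discriminant, whose coefficients are
written out. (If `Aτ² + Bτ + C = 0` then `Q'(gτ, 1) · (cτ + d)² = Q(τ, 1) = 0`, and the root in
`ℍ` is unique.) This is the classical compatibility of the root `τ_Q` with the action on forms
(Cox 2013, §7.B, (7.8)–(7.10); Gross–Kohnen–Zagier 1987, §I.1). [folklore] -/
theorem sl2_smul_heegnerTau (g : SL(2, ℤ)) {A B C : ℤ} (hA : 0 < A) (hD : B ^ 2 - 4 * A * C < 0) :
    g • heegnerTau (A, B, C) =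
      heegnerTau (A * g 1 1 ^ 2 - B * g 1 1 * g 1 0 + C * g 1 0 ^ 2,
        -(2 * A * g 0 1 * g 1 1) + B * (g 0 0 * g 1 1 + g 0 1 * g 1 0) - 2 * C * g 0 0 * g 1 0,
        A * g 0 1 ^ 2 - B * g 0 0 * g 0 1 + C * g 0 0 ^ 2) := by
  set a : ℤ := g 0 0
  set b : ℤ := g 0 1
  set c : ℤ := g 1 0
  set d : ℤ := g 1 1
  have hdet : a * d - b * c = 1 := by
    have h := Matrix.det_fin_two (g : Matrix (Fin 2) (Fin 2) ℤ)
    rw [g.det_coe] at h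
    exact h.symm
  -- the new form is positive definite with the same discriminant
  have hA' : 0 < A * d ^ 2 - B * d * c + C * c ^ 2 := by
    have h := posDef_of_disc_neg hA hD (x := d) (y := -c) (by
      by_contra h0
      simp only [not_or, not_ne_iff, neg_eq_zero] at h0
      rw [h0.1, h0.2] at hdet
      simp at hdet)
    linarith [show A * d ^ 2 + B * d * -c + C * (-c) ^ 2 = A * d ^ 2 - B * d * c + C * c ^ 2 by ring]
  have hD' : (-(2 * A * b * d) + B * (a * d + b * c) - 2 * C * a * c) ^ 2 -
      4 * (A * d ^ 2 - B * d * c + C * c ^ 2) * (A * b ^ 2 - B * a * b + C * a ^ 2) < 0 := by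
    have key : (-(2 * A * b * d) + B * (a * d + b * c) - 2 * C * a * c) ^ 2 -
        4 * (A * d ^ 2 - B * d * c + C * c ^ 2) * (A * b ^ 2 - B * a * b + C * a ^ 2) =
        (a * d - b * c) ^ 2 * (B ^ 2 - 4 * A * C) := by ring
    rw [key, hdet]
    simpa using hD
  symm
  refine (eq_heegnerTau_of_isRoot (Q := (_, _, _)) hA' hD' (g • heegnerTau (A, B, C)) ?_).symm
  -- the root equation for `g • τ_Q`
  set z : ℂ := (heegnerTau (A, B, C) : ℂ) with hz
  have hroot : (A : ℂ) * z ^ 2 + B * z + C = 0 := heegnerTau_isRoot (Q := (A, B, C)) hA hD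
  have hden : (c : ℂ) * z + d ≠ 0 := sl2z_denom_ne_zero g _
  have hw : ((g • heegnerTau (A, B, C) : ℍ) : ℂ) * ((c : ℂ) * z + d) = a * z + b := by
    rw [coe_specialLinearGroup_apply]
    simp only [eq_intCast, Complex.ofReal_intCast]
    show ((a : ℂ) * z + b) / ((c : ℂ) * z + d) * ((c : ℂ) * z + d) = a * z + b
    rw [div_mul_cancel₀ _ hden]
  set w : ℂ := ((g • heegnerTau (A, B, C) : ℍ) : ℂ) with hw'
  have key : ((c : ℂ) * z + d) ^ 2 *
      (((A * d ^ 2 - B * d * c + C * c ^ 2 : ℤ) : ℂ) * w ^ 2 +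
        ((-(2 * A * b * d) + B * (a * d + b * c) - 2 * C * a * c : ℤ) : ℂ) * w +
        ((A * b ^ 2 - B * a * b + C * a ^ 2 : ℤ) : ℂ)) = 0 := by
    push_cast
    linear_combination ((A * d ^ 2 - B * d * c + C * c ^ 2 : ℂ) * (w * (c * z + d) + (a * z + b)) +
      (-(2 * A * b * d) + B * (a * d + b * c) - 2 * C * a * c : ℂ) * (c * z + d)) * hw +
      ((a : ℂ) * d - b * c) ^ 2 * hroot
  simpa using (mul_eq_zero.mp key).resolve_left (pow_ne_zero 2 hden)

/-- `T^n · τ_Q = τ_Q + n` is the Heegner point of `(A, B − 2nA, C − nB + n²A)`. [folklore] -/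
theorem T_zpow_smul_heegnerTau (n : ℤ) {A B C : ℤ} (hA : 0 < A) (hD : B ^ 2 - 4 * A * C < 0) :
    ModularGroup.T ^ n • heegnerTau (A, B, C) = heegnerTau (A, B - 2 * n * A, C - n * B + n ^ 2 * A) := by
  rw [sl2_smul_heegnerTau _ hA hD]
  have h00 : (ModularGroup.T ^ n) 0 0 = 1 := by
    rw [ModularGroup.coe_T_zpow]; rfl
  have h01 : (ModularGroup.T ^ n) 0 1 = n := by
    rw [ModularGroup.coe_T_zpow]; rfl
  have h10 : (ModularGroup.T ^ n) 1 0 = 0 := by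
    rw [ModularGroup.coe_T_zpow]; rfl
  have h11 : (ModularGroup.T ^ n) 1 1 = 1 := by
    rw [ModularGroup.coe_T_zpow]; rfl
  rw [h00, h01, h10, h11]
  congr 1
  ext <;> simp <;> ring

/-- `S · τ_Q = −1/τ_Q` is the Heegner point of `(C, −B, A)`. [folklore] -/
theorem S_smul_heegnerTau {A B C : ℤ} (hA : 0 < A) (hD : B ^ 2 - 4 * A * C < 0) :
    ModularGroup.S • heegnerTau (A, B, C) = heegnerTau (C, -B, A) := by
  rw [sl2_smul_heegnerTau _ hA hD]
  have h00 : ModularGroup.S 0 0 = 0 := rfl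
  have h01 : ModularGroup.S 0 1 = -1 := rfl
  have h10 : ModularGroup.S 1 0 = 1 := rfl
  have h11 : ModularGroup.S 1 1 = 0 := rfl
  rw [h00, h01, h10, h11]
  congr 1
  ext <;> simp

/-! ### Reduction of positive definite forms -/

/-- **Reduction (Lagrange–Gauss).** Every positive definite integral form `(A, B, C)` is
`SL₂(ℤ)`-equivalent — at the level of its Heegner point `τ_Q ∈ ℍ` — to a *reduced* one,
`|B'| ≤ A' ≤ C'`, of the same discriminant: translate by `T^m` to get `|B| ≤ A`, and if then
`C < A` apply `S` (which swaps `A` and `C`) and induct on `A` (Cox 2013, Thm. 2.8, existence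
part of the proof; uniqueness is not needed here). [folklore] -/
theorem exists_sl2_smul_heegnerTau_reduced {A B C : ℤ} (hA : 0 < A) (hD : B ^ 2 - 4 * A * C < 0) :
    ∃ (g : SL(2, ℤ)) (A' B' C' : ℤ), 0 < A' ∧ B' ^ 2 - 4 * A' * C' = B ^ 2 - 4 * A * C ∧
      |B'| ≤ A' ∧ A' ≤ C' ∧ g • heegnerTau (A, B, C) = heegnerTau (A', B', C') := by
  suffices h : ∀ (n : ℕ) (A B C : ℤ), A.toNat = n → 0 < A → B ^ 2 - 4 * A * C < 0 →
      ∃ (g : SL(2, ℤ)) (A' B' C' : ℤ), 0 < A' ∧ B' ^ 2 - 4 * A' * C' = B ^ 2 - 4 * A * C ∧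
        |B'| ≤ A' ∧ A' ≤ C' ∧ g • heegnerTau (A, B, C) = heegnerTau (A', B', C') from
    h _ A B C rfl hA hD
  intro n
  induction n using Nat.strong_induction_on with
  | _ n ih =>
  intro A B C hn hA hD
  -- Step 1: translate so that `|B₁| ≤ A`.
  have h2A : (0 : ℤ) < 2 * A := by linarith
  set m : ℤ := (B + A) / (2 * A) with hm
  set r : ℤ := (B + A) % (2 * A) with hr
  have hr0 : 0 ≤ r := Int.emod_nonneg _ h2A.ne'
  have hr1 : r < 2 * A := Int.emod_lt_of_pos _ h2A
  have hmr : 2 * A * m + r = B + A := Int.mul_ediv_add_emod _ _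
  set B₁ : ℤ := B - 2 * m * A with hB₁
  set C₁ : ℤ := C - m * B + m ^ 2 * A with hC₁
  have hB₁le : |B₁| ≤ A := by
    rw [abs_le]
    constructor <;> linarith
  have hdisc₁ : B₁ ^ 2 - 4 * A * C₁ = B ^ 2 - 4 * A * C := by
    rw [hB₁, hC₁]; ring
  have hD₁ : B₁ ^ 2 - 4 * A * C₁ < 0 := hdisc₁ ▸ hD
  have hT : ModularGroup.T ^ m • heegnerTau (A, B, C) = heegnerTau (A, B₁, C₁) :=
    T_zpow_smul_heegnerTau m hA hD
  by_cases hAC : A ≤ C₁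
  · exact ⟨ModularGroup.T ^ m, A, B₁, C₁, hA, hdisc₁, hB₁le, hAC, hT⟩
  -- Step 2: `C₁ < A`: apply `S` and induct.
  push Not at hAC
  have hC₁pos : 0 < C₁ := third_pos_of_disc_neg hA hD₁
  have hS : ModularGroup.S • heegnerTau (A, B₁, C₁) = heegnerTau (C₁, -B₁, A) :=
    S_smul_heegnerTau hA hD₁
  have hD₂ : (-B₁) ^ 2 - 4 * C₁ * A < 0 := by linarith [show (-B₁) ^ 2 - 4 * C₁ * A = B₁ ^ 2 - 4 * A * C₁ by ring]
  have hlt : C₁.toNat < n := by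
    rw [← hn]
    exact (Int.toNat_lt_toNat hA).mpr hAC
  obtain ⟨g', A', B', C', hA', hdisc', hB', hAC', hg'⟩ := ih _ hlt C₁ (-B₁) A rfl hC₁pos hD₂
  refine ⟨g' * ModularGroup.S * ModularGroup.T ^ m, A', B', C', hA', ?_, hB', hAC', ?_⟩
  · rw [hdisc', ← hdisc₁]; ring
  · rw [mul_smul, mul_smul, hT, hS, hg']

/-- **Finitely many reduced forms of given discriminant.** For `D < 0` the reduced positive
definite forms `(A, B, C)` (`|B| ≤ A ≤ C`) of discriminant `D` satisfy `3A² ≤ |D|`, hence form a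
finite set (Cox 2013, (2.12) and Thm. 2.13). [folklore] -/
theorem finite_reducedForms (D : ℤ) :
    {Q : ℤ × ℤ × ℤ | Q.2.1 ^ 2 - 4 * Q.1 * Q.2.2 = D ∧ 0 < Q.1 ∧ |Q.2.1| ≤ Q.1 ∧ Q.1 ≤ Q.2.2}.Finite := by
  set M : ℤ := D ^ 2 - D with hM
  refine ((Set.finite_Icc (-M) M).prod ((Set.finite_Icc (-M) M).prod
    (Set.finite_Icc (-M) M))).subset ?_
  rintro ⟨A, B, C⟩ ⟨hdisc, hA, hB, hAC⟩
  dsimp only at hdisc hA hB hAC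
  simp only [Set.mem_prod, Set.mem_Icc]
  obtain ⟨hB1, hB2⟩ := abs_le.mp hB
  have hBB : B ^ 2 ≤ A ^ 2 := by nlinarith
  have hD0 : D < 0 := by nlinarith
  have h3 : 3 * A ^ 2 ≤ -D := by nlinarith
  have hA' : A ≤ -D := by nlinarith
  have hA2 : A ^ 2 ≤ D ^ 2 := by nlinarith
  have hC0 : 0 < C := by linarith
  have hC : C ≤ M := by nlinarith
  have hM0 : 0 ≤ M := by nlinarith
  refine ⟨⟨by linarith, by linarith⟩, ⟨by linarith, by linarith⟩, by linarith, hC⟩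

/-- The form `Q ∘ g⁻¹` of `sl2_smul_heegnerTau` has the same discriminant as `Q`. [folklore] -/
theorem sl2_act_disc (g : SL(2, ℤ)) (A B C : ℤ) :
    (-(2 * A * g 0 1 * g 1 1) + B * (g 0 0 * g 1 1 + g 0 1 * g 1 0) - 2 * C * g 0 0 * g 1 0) ^ 2 -
      4 * (A * g 1 1 ^ 2 - B * g 1 1 * g 1 0 + C * g 1 0 ^ 2) *
        (A * g 0 1 ^ 2 - B * g 0 0 * g 0 1 + C * g 0 0 ^ 2) = B ^ 2 - 4 * A * C := by
  have hdet : g 0 0 * g 1 1 - g 0 1 * g 1 0 = 1 := by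
    have h := Matrix.det_fin_two (g : Matrix (Fin 2) (Fin 2) ℤ)
    rw [g.det_coe] at h
    exact h.symm
  linear_combination (B ^ 2 - 4 * A * C) * (g 0 0 * g 1 1 - g 0 1 * g 1 0 + 1) * hdet

/-- The form `Q ∘ g⁻¹` of `sl2_smul_heegnerTau` is positive definite if `Q` is. [folklore] -/
theorem sl2_act_fst_pos (g : SL(2, ℤ)) {A B C : ℤ} (hA : 0 < A) (hD : B ^ 2 - 4 * A * C < 0) :
    0 < A * g 1 1 ^ 2 - B * g 1 1 * g 1 0 + C * g 1 0 ^ 2 := by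
  have hdet : g 0 0 * g 1 1 - g 0 1 * g 1 0 = 1 := by
    have h := Matrix.det_fin_two (g : Matrix (Fin 2) (Fin 2) ℤ)
    rw [g.det_coe] at h
    exact h.symm
  have h := posDef_of_disc_neg hA hD (x := g 1 1) (y := -g 1 0) (by
    by_contra h0
    simp only [not_or, not_ne_iff, neg_eq_zero] at h0
    rw [h0.1, h0.2] at hdet
    simp at hdet)
  linarith [show A * g 1 1 ^ 2 + B * g 1 1 * -g 1 0 + C * (-g 1 0) ^ 2 =
    A * g 1 1 ^ 2 - B * g 1 1 * g 1 0 + C * g 1 0 ^ 2 by ring]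

/-! ### Finitely many `Γ₀(N)`-classes; existence of Heegner data -/

/-- **Finiteness of `Γ₀(N)`-classes of positive definite forms of discriminant `D`.** There is a
finite set `F` of positive definite forms of discriminant `D < 0` such that every positive definite
form of discriminant `D` is `Γ₀(N)`-equivalent (`IsGamma0Equiv`, i.e. its Heegner point lies in the
same `Γ₀(N)`-orbit) to a member of `F`: take `F = {Q_red ∘ r : Q_red reduced, r ∈ R}` for a
(finite, `Γ₀(N)` having finite index) system `R` of coset representatives of `Γ₀(N)` in `SL₂(ℤ)`
(Gross–Kohnen–Zagier 1987, §I.1: the classes of Heegner forms modulo `Γ₀(N)`; Cox 2013,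
Thm. 2.13 for `N = 1`). [folklore] -/
theorem exists_finset_forall_isGamma0Equiv (N : ℕ) [NeZero N] {D : ℤ} (hD : D < 0) :
    ∃ F : Finset (ℤ × ℤ × ℤ), (∀ Q' ∈ F, 0 < Q'.1 ∧ Q'.2.1 ^ 2 - 4 * Q'.1 * Q'.2.2 = D) ∧
      ∀ Q : ℤ × ℤ × ℤ, 0 < Q.1 → Q.2.1 ^ 2 - 4 * Q.1 * Q.2.2 = D →
        ∃ Q' ∈ F, IsGamma0Equiv N Q Q' := by
  classical
  -- the form `Q ∘ g⁻¹` with `g • τ_Q = τ_{Q ∘ g⁻¹}`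
  let act : SL(2, ℤ) → ℤ × ℤ × ℤ → ℤ × ℤ × ℤ := fun g Q ↦
    (Q.1 * g 1 1 ^ 2 - Q.2.1 * g 1 1 * g 1 0 + Q.2.2 * g 1 0 ^ 2,
      -(2 * Q.1 * g 0 1 * g 1 1) + Q.2.1 * (g 0 0 * g 1 1 + g 0 1 * g 1 0) -
        2 * Q.2.2 * g 0 0 * g 1 0,
      Q.1 * g 0 1 ^ 2 - Q.2.1 * g 0 0 * g 0 1 + Q.2.2 * g 0 0 ^ 2)
  have hact : ∀ (g : SL(2, ℤ)) (Q : ℤ × ℤ × ℤ), 0 < Q.1 → Q.2.1 ^ 2 - 4 * Q.1 * Q.2.2 < 0 →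
      g • heegnerTau Q = heegnerTau (act g Q) ∧ 0 < (act g Q).1 ∧
        (act g Q).2.1 ^ 2 - 4 * (act g Q).1 * (act g Q).2.2 = Q.2.1 ^ 2 - 4 * Q.1 * Q.2.2 := by
    rintro g ⟨A, B, C⟩ hA hD
    exact ⟨sl2_smul_heegnerTau g hA hD, sl2_act_fst_pos g hA hD, sl2_act_disc g A B C⟩
  -- coset representatives of `Γ₀(N)` and reduced forms
  haveI : Fintype (SL(2, ℤ) ⧸ Gamma0 N) := Fintype.ofFinite _
  let R : Finset SL(2, ℤ) := Finset.univ.image (fun q : SL(2, ℤ) ⧸ Gamma0 N ↦ q.out)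
  let Sred : Finset (ℤ × ℤ × ℤ) := (finite_reducedForms D).toFinset
  refine ⟨(R ×ˢ Sred).image (fun p ↦ act p.1⁻¹ p.2), ?_, ?_⟩
  · intro Q' hQ'
    obtain ⟨⟨r, Qr⟩, hp, rfl⟩ := Finset.mem_image.mp hQ'
    obtain ⟨-, hQr⟩ := Finset.mem_product.mp hp
    obtain ⟨hdisc, hpos, -, -⟩ := (Set.Finite.mem_toFinset _).mp hQr
    have hQrD : Qr.2.1 ^ 2 - 4 * Qr.1 * Qr.2.2 < 0 := by rw [hdisc]; exact hD
    exact ⟨(hact r⁻¹ Qr hpos hQrD).2.1, by rw [(hact r⁻¹ Qr hpos hQrD).2.2, hdisc]⟩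
  · rintro ⟨A, B, C⟩ hA hdiscQ
    dsimp only at hA hdiscQ
    have hDQ : B ^ 2 - 4 * A * C < 0 := by rw [hdiscQ]; exact hD
    obtain ⟨g, A', B', C', hA', hdisc', hB', hAC', hg⟩ := exists_sl2_smul_heegnerTau_reduced hA hDQ
    have hD' : B' ^ 2 - 4 * A' * C' < 0 := by rw [hdisc']; exact hDQ
    have hQr : (A', B', C') ∈ Sred :=
      (Set.Finite.mem_toFinset _).mpr ⟨by rw [← hdiscQ, ← hdisc'], hA', hB', hAC'⟩
    obtain ⟨h, hh⟩ := QuotientGroup.mk_out_eq_mul (Gamma0 N) g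
    set r : SL(2, ℤ) := (QuotientGroup.mk g : SL(2, ℤ) ⧸ Gamma0 N).out with hr
    have hrR : r ∈ R := Finset.mem_image.mpr ⟨QuotientGroup.mk g, Finset.mem_univ _, rfl⟩
    refine ⟨act r⁻¹ (A', B', C'),
      Finset.mem_image.mpr ⟨(r, (A', B', C')), Finset.mem_product.mpr ⟨hrR, hQr⟩, rfl⟩, h⁻¹, ?_⟩
    rw [← (hact r⁻¹ (A', B', C') hA' hD').1, hh, ← hg, mul_inv_rev, mul_smul, inv_smul_smul,
      Subgroup.smul_def, Subgroup.coe_inv]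

/-- **Heegner data exist** for every level `N ≥ 1`, negative discriminant `D` and residue `β`
with `β² ≡ D (mod 4N)`: the Heegner forms `(A, B, C)` of level `N`, discriminant `D` and
`B ≡ β (mod 2N)` fall into finitely many `Γ₀(N)`-classes (`exists_finset_forall_isGamma0Equiv`),
so a complete irredundant system of representatives can be chosen (one canonical form per class,
via Hilbert's `ε`). For a fundamental `D = d_K` the classes correspond to `Cl(K)`
(Gross 1984, §I.1; Gross–Kohnen–Zagier 1987, §I.1, Prop.), which is not used here. [folklore] -/
theorem exists_heegnerDatum (N : ℕ) [NeZero N] {D : ℤ} (hD : D < 0) {β : ℤ}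
    (hβ : (4 * N : ℤ) ∣ β ^ 2 - D) : ∃ H : HeegnerDatum N D, H.β = β := by
  classical
  obtain ⟨F, -, hcomplete⟩ := exists_finset_forall_isGamma0Equiv N hD
  -- `Γ₀(N)`-equivalence is an equivalence relation (cf. `HeegnerPointsProofs`)
  have hsymm : ∀ {x y : ℤ × ℤ × ℤ}, IsGamma0Equiv N x y → IsGamma0Equiv N y x :=
    fun ⟨γ, h⟩ ↦ ⟨γ⁻¹, by rw [← h, inv_smul_smul]⟩
  have htrans : ∀ {x y z : ℤ × ℤ × ℤ}, IsGamma0Equiv N x y → IsGamma0Equiv N y z →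
      IsGamma0Equiv N x z := fun ⟨γ, h⟩ ⟨γ', h'⟩ ↦ ⟨γ' * γ, by rw [mul_smul, h, h']⟩
  -- the Heegner forms with `B ≡ β (mod 2N)` and a canonical representative of each class
  let S : Set (ℤ × ℤ × ℤ) := {Q | Q ∈ heegnerForms N D ∧ Q.2.1 ≡ β [ZMOD 2 * N]}
  let P : (ℤ × ℤ × ℤ) → (ℤ × ℤ × ℤ) → Prop := fun x Q' ↦ Q' ∈ S ∧ IsGamma0Equiv N x Q'
  let canon : (ℤ × ℤ × ℤ) → ℤ × ℤ × ℤ := fun x ↦ Classical.epsilon (P x)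
  have hP : ∀ {x y}, IsGamma0Equiv N x y → P x = P y := fun hxy ↦ by
    funext Q'
    exact propext ⟨fun ⟨h1, h2⟩ ↦ ⟨h1, htrans (hsymm hxy) h2⟩, fun ⟨h1, h2⟩ ↦ ⟨h1, htrans hxy h2⟩⟩
  have hcanon_eq : ∀ {x y}, IsGamma0Equiv N x y → canon x = canon y := fun hxy ↦ by
    show Classical.epsilon (P _) = Classical.epsilon (P _)
    rw [hP hxy]
  have hcanon_spec : ∀ x, (∃ Q', P x Q') → P x (canon x) := fun x hex ↦ Classical.epsilon_spec hex
  let F' : Finset (ℤ × ℤ × ℤ) := F.filter (fun f ↦ ∃ Q ∈ S, IsGamma0Equiv N Q f)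
  have hF' : ∀ f ∈ F', canon f ∈ S ∧ IsGamma0Equiv N f (canon f) := fun f hf ↦ by
    obtain ⟨-, Q₀, hQ₀S, hQ₀f⟩ := Finset.mem_filter.mp hf
    exact hcanon_spec f ⟨Q₀, hQ₀S, hsymm hQ₀f⟩
  refine ⟨⟨β, hβ, F'.image canon, ?_, ?_, ?_⟩, rfl⟩
  · intro Q hQ
    obtain ⟨f, hf, rfl⟩ := Finset.mem_image.mp hQ
    exact (hF' f hf).1
  · intro Q₁ hQ₁ Q₂ hQ₂ hne h12
    obtain ⟨f₁, hf₁, rfl⟩ := Finset.mem_image.mp (Finset.mem_coe.mp hQ₁)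
    obtain ⟨f₂, hf₂, rfl⟩ := Finset.mem_image.mp (Finset.mem_coe.mp hQ₂)
    exact hne (hcanon_eq (htrans (hF' f₁ hf₁).2 (htrans h12 (hsymm (hF' f₂ hf₂).2))))
  · intro Q hQ hQβ
    obtain ⟨f, hfF, hQf⟩ := hcomplete Q hQ.2.1 hQ.1
    have hfF' : f ∈ F' := Finset.mem_filter.mpr ⟨hfF, Q, ⟨hQ, hQβ⟩, hQf⟩
    exact ⟨canon f, Finset.mem_image_of_mem _ hfF', htrans hQf (hF' f hfF').2⟩

/-- **Discharge of `Literature.NumberTheory.EllipticCurves.nonempty_heegnerDatum`** (existence of Heegner data, Gross 1984, §I.1;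
Gross–Kohnen–Zagier 1987, §I.1): for `K` imaginary quadratic (`d_K < 0`,
`IsImaginaryQuadratic.discr_neg`) and `β² ≡ d_K (mod 4N)` there is a Heegner datum of level
`N`, discriminant `d_K` and residue `β` (`exists_heegnerDatum`). [cite: Gross1984, §I.1] -/
theorem nonempty_heegnerDatum_holds (N : ℕ) [NeZero N] (K : Type*) [Field K] [NumberField K] :
    nonempty_heegnerDatum N K := by
  intro hK β hβ
  exact exists_heegnerDatum N hK.discr_neg hβ

end Literature.NumberTheory.EllipticCurves
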